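/-
Copyright (c) 2026 the pub-hodgecm-mathlib formalisation cell (harness21).  Prover seat hodgecm-mathlib-K2E3-p32 (g0), HCML Track B «K2-LIT» (close-out strike line L4
`stub_StCharTS`), h413 = `stmt-HodgeConjecture-24833`, line `K2_E3_EllipticInputs`, PART «SC» socket (SC-an)₂ `sig_K2E3SupercuspidalTruncatedCharAnalyticTwo`, the (M5h₂)
chain (dealer K2E3-plan (g4) EMIT #1 2026-09-04T14:52:25Z, deal D137): the `U(1,1)` twin of the rank-ONE half of ★ `K2E3CuspFormCancellationU3Inputs` (K2E3-p21 (g3)) —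
HARISH-CHANDRA'S THEOREM 20 «cusp-form cancellation», DISCHARGE at the model `U(σ, Φ₂)(K)`, FILE 2 «THE HYPOTHESES OF ★ (T20-e2)».  2026-09-04.
-/
import Summits.HodgeConjecture.HodgeConjecture.Theorems.K2E3CuspFormCancellationU2Torus          -- ★ FILE 1 (this seat): torus of `U(σ,Φ₂)` in the height-ball currency, any-rank Iwahori orders
import Summits.HodgeConjecture.HodgeConjecture.Theorems.K2E3CuspFormCancellationInputsAnyRank   -- ★ (this seat): the rank-free hypotheses (`hT`, `hnormN∕Nbar`, Lemma 54, shapes of `N`, `N̄`, the two generic bounds)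
import Summits.HodgeConjecture.HodgeConjecture.Theorems.K2E3CuspFormCancellationU3Inputs         -- ★ the `Φ₃` original (K2E3-p21 (g3)): its rank-free `valuation_pow_le_one`
import HarnessLib

/-!
# h413 ∕ Track B «K2-LIT», (SC-an)₂ Theorem-20 line at `U(1,1)` — DISCHARGE FILE 2: THE RANK-ONE HYPOTHESES OF ★ (T20-e2) `cuspForm_trichotomy_*` AT `U(σ, Φ₂)(K)`
# (`hAcover`, `hplusV`, `hminusV`, `hplusC`, `hminusC`, `K_γ ⊆ Ω_0`)  (Harish-Chandra 1970, Part VII §8 Lemmas 55–56 pp. 81–83; Casselman 1995, Prop. 1.4.3)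

Cell `pub/hodgecm-mathlib`, crux H413 = `stmt-HodgeConjecture-24833`, route of record `HCCMUnconditional`; chair K2-lead (g2), LINE-LEAD∕dealer K2E3-plan (g4),
architect K2E3-p25 (g3).  THEOREMS ONLY (no `def`, no `instance`, no `notation`, no named-fact hypothesis, no `sorry`); lane `--supports stmt-HodgeConjecture-24833 --as helper`.

THE PORT.  ★ `K2E3CuspFormCancellationU3Inputs` (K2E3-p21 (g3)) with `Φ₃ ↦ Φ₂`, TOKEN FOR TOKEN, for the statements that are genuinely rank-one: the `A⁺ ∪ A⁻` cover of the torus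
by `|d₀| ≷ 1` and the four conjugation bounds, which use the single root value `|d₀|^{∓2}` of ★ FILE 1 `K2E3CuspFormCancellationU2Torus` (`v_ratio_le_*`,
`v_inv_le_pow_succ_of_not_mem`, `v_le_pow_succ_of_not_mem`); the rank-free hypotheses (`hT`, `hnormN`, `hnormNbar`, Lemma 54, the shapes of `N`, `N̄`, the two generic
`ValBound` lemmas, the conjugate level) are ★ `K2E3CuspFormCancellationInputsAnyRank` (this seat, any rank) and are used BY NAME, as are ★ U3Inputs `valuation_pow_le_one`
and ★ (T20-c) §LevelZero.  SETTING: `K` a field with compatible `Valued K ℤᵐ⁰` ∕ `ValuativeRel`, `σ : K →+* K` isometric, `J = Φ₂`, `U = ↥(unitaryGroupOfForm σ J)`; a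
uniformiser `ϖ`; an abstract `Ω : ℕ → Set U` with the MEMBERSHIP of ★ `exists_heightBall_compactExhaustion` (`hmem`) and its inversion symmetry (`hinv`); `T = torusU`,
`N = (borelTriple σ J hJ).N` (a LINE at `N = 2`), `N̄ = N.map (conj w₀)`; levels `K_γ := (congruenceGL 2 γ).comap U.subtype`; `A^± := {a : ∃ d, diag d = a ∧ |d₀| ≷ 1}`
(set-builder terms; no definition is introduced).
* `torusU_mem_plus_or_minus` (`hAcover`), `mem_level_of_valBound`; **`conj_mem_level_of_plus_of_mem_Nbar`** (`hplusV`), **`conj_mem_level_of_minus_of_mem_N`** (`hminusV`),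
  **`inv_conj_mem_level_of_plus_of_mem_N`** (`hplusC`), **`inv_conj_mem_level_of_minus_of_mem_Nbar`** (`hminusC`); `coe_level_subset_heightBall_zero` (`K_γ ⊆ Ω_0`).
With ★ FILE 1 §3 (`exists_iwahori_factorisations_of_mem_level`), ★ InputsAnyRank and ★ (T20-c) §Twist these are ALL the structural inputs of ★ (T20-e1)∕(T20-e1′) at
`U(σ,Φ₂)(K)` — assembled in FILE 3 (`K2E3CuspFormCancellationU2LevelOne`).

HONEST LABEL.  HC_CM is proved only modulo the 7 printed citations (2 remaining named inputs: hLiu418 = `stmt-HodgeConjecture-24832`, h413 = `stmt-HodgeConjecture-24833`)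
until rung 0 closes; count-neutral helper; (SC-an)₂ is NOT ★ until COLL₂ + NC₂ + the whole (M5h₂) chain land.

## References
* [HarishChandra1970] Harish-Chandra (notes by G. van Dijk), *Harmonic Analysis on Reductive p-adic Groups*, LNM 162 (1970), Part VII §2 p. 69; §8 pp. 80–83 (Lemmas 55–56).
* [Casselman1995] W. Casselman, *Introduction to the theory of admissible representations of `p`-adic reductive groups* (1995 notes), Prop. 1.4.3.
* [Rogawski1990] J. D. Rogawski, *Automorphic Representations of Unitary Groups in Three Variables*, Ann. of Math. Stud. 123 (1990), §1.9–§1.10 pp. 8–9 (`U(1,1)`, `B = MN`, `w₀`).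
-/

set_option autoImplicit false
set_option linter.dupNamespace false  -- the mandated namespace repeats the single-problem summit's segment (`HodgeConjecture.HodgeConjecture`)

noncomputable section

open scoped MatrixGroups WithZero Pointwise
open ValuativeRel Matrix
open Literature.NumberTheory.Automorphic Literature.NumberTheory.Automorphic.UnitaryGroup
open Summit.HodgeConjecture.HodgeConjecture.Cruxes.H413.K2E3CuspFormCancellationU2Torus
open Summit.HodgeConjecture.HodgeConjecture.Cruxes.H413.K2E3CuspFormCancellationInputsAnyRank

namespace Summit.HodgeConjecture.HodgeConjecture.Cruxes.H413.K2E3CuspFormCancellationU2Inputs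

/-! ## `U(σ, Φ₂)(K)`: the `A⁺ ∪ A⁻` cover, the four conjugation bounds, `K_γ ⊆ Ω_0` -/

section Model

variable {K : Type*} [Field K] [Valued K ℤᵐ⁰] [ValuativeRel K] [(Valued.v : Valuation K ℤᵐ⁰).Compatible]
  (σ : K →+* K) (hσv : ∀ x, Valued.v (σ x) = Valued.v x) {J : Matrix (Fin 2) (Fin 2) K} (hJ : J = (StdForm.antidiagonal 2).over K)
  {ϖ : K} (hϖ : Valued.v ϖ = WithZero.exp (-1 : ℤ))
  (Ω : ℕ → Set ↥(unitaryGroupOfForm σ J))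
  (hmem : ∀ (m : ℕ) (g : ↥(unitaryGroupOfForm σ J)), g ∈ Ω m ↔
    (∀ i j, Valued.v (ϖ ^ m * ((g : GL (Fin 2) K) : Matrix (Fin 2) (Fin 2) K) i j) ≤ 1) ∧
      ∀ i j, Valued.v (ϖ ^ m * (((g : GL (Fin 2) K)⁻¹ : GL (Fin 2) K) : Matrix (Fin 2) (Fin 2) K) i j) ≤ 1)
  (hinv : ∀ (m : ℕ) (g : ↥(unitaryGroupOfForm σ J)), g ∈ Ω m → g⁻¹ ∈ Ω m)

omit [ValuativeRel K] [(Valued.v : Valuation K ℤᵐ⁰).Compatible] in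
/-- **`hAcover`**: every `a ∈ T` lies in `A⁺ = {|d₀| ≥ 1}` or in `A⁻ = {|d₀| ≤ 1}`. [cite: HarishChandra1970, Part VII §8 p. 81] -/
theorem torusU_mem_plus_or_minus :
    ∀ a ∈ (borelTriple σ J hJ).M,
      a ∈ {a : ↥(unitaryGroupOfForm σ J) | ∃ d : Fin 2 → Kˣ, glDiagonal 2 K d = (a : GL (Fin 2) K) ∧ 1 ≤ Valued.v (d 0 : K)} ∨
      a ∈ {a : ↥(unitaryGroupOfForm σ J) | ∃ d : Fin 2 → Kˣ, glDiagonal 2 K d = (a : GL (Fin 2) K) ∧ Valued.v (d 0 : K) ≤ 1} := by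
  intro a ha
  obtain ⟨d, hd⟩ := (mem_torusU_iff a).1 ha
  rcases le_total 1 (Valued.v (d 0 : K)) with h | h
  · exact Or.inl ⟨d, hd, h⟩
  · exact Or.inr ⟨d, hd, h⟩

omit [Valued K ℤᵐ⁰] [(Valued.v : Valuation K ℤᵐ⁰).Compatible] in
/-- Membership in a level `K_γ ∩ U`, `γ ≤ 1`, from the two `ValBound`s of `g − 1` and `g⁻¹ − 1` (integrality is automatic). [cite: Casselman1995, Prop. 1.4.3] -/
theorem mem_level_of_valBound {γ : ValueGroupWithZero K} (hγ : γ ≤ 1) {g : ↥(unitaryGroupOfForm σ J)}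
    (h1 : ValBound γ (((g : GL (Fin 2) K) : Matrix (Fin 2) (Fin 2) K) - 1))
    (h2 : ValBound γ ((((g : GL (Fin 2) K)⁻¹ : GL (Fin 2) K) : Matrix (Fin 2) (Fin 2) K) - 1)) :
    g ∈ (congruenceGL 2 γ).comap (unitaryGroupOfForm σ J).subtype :=
  ⟨⟨h1.of_sub_one hγ, h2.of_sub_one hγ⟩, h1, h2⟩

include hσv hJ in
/-- **`hplusV`**: for `a ∈ A⁺` (`a = diag d`, `1 ≤ |d₀|`) and `v ∈ K_γ ⊓ N̄` (`γ ≤ 1`): `a v a⁻¹ ∈ K_γ` — below the diagonal `|d_i d_j⁻¹| ≤ 1` (★ FILE 1 `v_ratio_le_one_of_gt`),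
above it `v_{ij} = 0`. [cite: HarishChandra1970, Part VII §8 p. 81] -/
theorem conj_mem_level_of_plus_of_mem_Nbar {γ : ValueGroupWithZero K} (hγ : γ ≤ 1) :
    ∀ a ∈ {a : ↥(unitaryGroupOfForm σ J) | ∃ d : Fin 2 → Kˣ, glDiagonal 2 K d = (a : GL (Fin 2) K) ∧ 1 ≤ Valued.v (d 0 : K)},
      ∀ v ∈ (congruenceGL 2 γ).comap (unitaryGroupOfForm σ J).subtype ⊓ ((borelTriple σ J hJ).N).map (MulAut.conj (weylLongU σ hJ)).toMonoidHom,
        a * v * a⁻¹ ∈ (congruenceGL 2 γ).comap (unitaryGroupOfForm σ J).subtype := by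
  rintro a ⟨d, hd, hplus⟩ v hv
  obtain ⟨hvK, hvN⟩ := Subgroup.mem_inf.1 hv
  have hvK' : (v : GL (Fin 2) K) ∈ congruenceGL 2 γ := hvK
  have key : ∀ x : ↥(unitaryGroupOfForm σ J), (x : GL (Fin 2) K) ∈ congruenceGL 2 γ →
      x ∈ ((borelTriple σ J hJ).N).map (MulAut.conj (weylLongU σ hJ)).toMonoidHom →
      ValBound γ ((((a * x * a⁻¹ : ↥(unitaryGroupOfForm σ J)) : GL (Fin 2) K) : Matrix (Fin 2) (Fin 2) K) - 1) := by
    intro x hxK hxN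
    obtain ⟨h1, h0⟩ := apply_of_mem_Nbar σ hJ hxN
    have hmat : (((a * x * a⁻¹ : ↥(unitaryGroupOfForm σ J)) : GL (Fin 2) K) : Matrix (Fin 2) (Fin 2) K) =
        diagonal (fun i => (d i : K)) * ((x : GL (Fin 2) K) : Matrix (Fin 2) (Fin 2) K) * diagonal fun i => ((d i : K))⁻¹ := by
      ext i j; rw [coe_conj_diag_apply σ hd, K2E3CuspFormCancellationU3Torus.diagonal_mul_mul_diagonal_apply]
    rw [hmat]
    refine valBound_diag_conj_sub_one d h1 hxK.2.1 fun i j hij hne => ?_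
    rcases lt_or_gt_of_ne hij with hlt | hgt
    · exact absurd (h0 i j hlt) hne
    · exact v_ratio_le_one_of_gt σ hσv hJ hd hplus hgt
  refine mem_level_of_valBound σ hγ (key v hvK' hvN) ?_
  have e : ((a * v * a⁻¹ : ↥(unitaryGroupOfForm σ J)) : GL (Fin 2) K)⁻¹ = ((a * v⁻¹ * a⁻¹ : ↥(unitaryGroupOfForm σ J)) : GL (Fin 2) K) := by
    rw [← Subgroup.coe_inv]; congr 1; group
  rw [e]
  exact key v⁻¹ ((congruenceGL 2 γ).inv_mem hvK') (Subgroup.inv_mem _ hvN)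

include hσv hJ in
/-- **`hminusV`**: for `a ∈ A⁻` (`|d₀| ≤ 1`) and `u ∈ K_γ ⊓ N`: `a u a⁻¹ ∈ K_γ` (above the diagonal `|d_i d_j⁻¹| ≤ 1`, below it `u_{ij} = 0`).
[cite: HarishChandra1970, Part VII §8 p. 81] -/
theorem conj_mem_level_of_minus_of_mem_N {γ : ValueGroupWithZero K} (hγ : γ ≤ 1) :
    ∀ a ∈ {a : ↥(unitaryGroupOfForm σ J) | ∃ d : Fin 2 → Kˣ, glDiagonal 2 K d = (a : GL (Fin 2) K) ∧ Valued.v (d 0 : K) ≤ 1},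
      ∀ u ∈ (congruenceGL 2 γ).comap (unitaryGroupOfForm σ J).subtype ⊓ (borelTriple σ J hJ).N,
        a * u * a⁻¹ ∈ (congruenceGL 2 γ).comap (unitaryGroupOfForm σ J).subtype := by
  rintro a ⟨d, hd, hminus⟩ u hu
  obtain ⟨huK, huN⟩ := Subgroup.mem_inf.1 hu
  have huK' : (u : GL (Fin 2) K) ∈ congruenceGL 2 γ := huK
  have key : ∀ x : ↥(unitaryGroupOfForm σ J), (x : GL (Fin 2) K) ∈ congruenceGL 2 γ → x ∈ (borelTriple σ J hJ).N →
      ValBound γ ((((a * x * a⁻¹ : ↥(unitaryGroupOfForm σ J)) : GL (Fin 2) K) : Matrix (Fin 2) (Fin 2) K) - 1) := by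
    intro x hxK hxN
    obtain ⟨h1, h0⟩ := apply_of_mem_N σ hJ hxN
    have hmat : (((a * x * a⁻¹ : ↥(unitaryGroupOfForm σ J)) : GL (Fin 2) K) : Matrix (Fin 2) (Fin 2) K) =
        diagonal (fun i => (d i : K)) * ((x : GL (Fin 2) K) : Matrix (Fin 2) (Fin 2) K) * diagonal fun i => ((d i : K))⁻¹ := by
      ext i j; rw [coe_conj_diag_apply σ hd, K2E3CuspFormCancellationU3Torus.diagonal_mul_mul_diagonal_apply]
    rw [hmat]
    refine valBound_diag_conj_sub_one d h1 hxK.2.1 fun i j hij hne => ?_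
    rcases lt_or_gt_of_ne hij with hlt | hgt
    · exact v_ratio_le_one_of_lt σ hσv hJ hd hminus hlt
    · exact absurd (h0 i j hgt) hne
  refine mem_level_of_valBound σ hγ (key u huK' huN) ?_
  have e : ((a * u * a⁻¹ : ↥(unitaryGroupOfForm σ J)) : GL (Fin 2) K)⁻¹ = ((a * u⁻¹ * a⁻¹ : ↥(unitaryGroupOfForm σ J)) : GL (Fin 2) K) := by
    rw [← Subgroup.coe_inv]; congr 1; group
  rw [e]
  exact key u⁻¹ ((congruenceGL 2 γ).inv_mem huK') (Subgroup.inv_mem _ huN)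

include hσv hJ hϖ hmem hinv in
/-- **`hplusC`** (Lemma 55 for `A⁺` on `N`): for `a ∈ A⁺` with `a ∉ Ω_h`, `j + c ≤ h + 1`, and `n ∈ N ∩ Ω_c`: `a⁻¹ n a ∈ K_{|ϖ|^j}` — the root values above the diagonal are
`≤ |d₀⁻¹| ≤ |ϖ^{h+1}|` (★ FILE 1), the entries of `n^{±1}` are `≤ |ϖ|^{−c}`. [cite: HarishChandra1970, Part VII §8 Lemma 55 p. 83] [cite: Casselman1995, Prop. 1.4.3] -/
theorem inv_conj_mem_level_of_plus_of_mem_N :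
    ∀ a ∈ {a : ↥(unitaryGroupOfForm σ J) | ∃ d : Fin 2 → Kˣ, glDiagonal 2 K d = (a : GL (Fin 2) K) ∧ 1 ≤ Valued.v (d 0 : K)},
      ∀ (h c j : ℕ), a ∉ Ω h → j + c ≤ h + 1 → ∀ n ∈ (borelTriple σ J hJ).N, n ∈ Ω c →
        a⁻¹ * n * a ∈ (congruenceGL 2 (valuation K ϖ ^ j)).comap (unitaryGroupOfForm σ J).subtype := by
  rintro a ⟨d, hd, hplus⟩ h c j hah hjc n hn hnc
  have hρ : Valued.v ((d 0 : K))⁻¹ ≤ Valued.v (ϖ ^ (h + 1)) := v_inv_le_pow_succ_of_not_mem σ hσv hJ hϖ Ω hmem hd hplus hah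
  have key : ∀ x : ↥(unitaryGroupOfForm σ J), x ∈ (borelTriple σ J hJ).N → x ∈ Ω c →
      ValBound (valuation K ϖ ^ j) ((((a⁻¹ * x * a : ↥(unitaryGroupOfForm σ J)) : GL (Fin 2) K) : Matrix (Fin 2) (Fin 2) K) - 1) := by
    intro x hxN hxc
    obtain ⟨h1, h0⟩ := apply_of_mem_N σ hJ hxN
    have hmat : (((a⁻¹ * x * a : ↥(unitaryGroupOfForm σ J)) : GL (Fin 2) K) : Matrix (Fin 2) (Fin 2) K) =
        diagonal (fun i => ((d i : K))⁻¹) * ((x : GL (Fin 2) K) : Matrix (Fin 2) (Fin 2) K) * diagonal fun i => (d i : K) := by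
      ext i j; rw [coe_inv_conj_diag_apply σ hd, K2E3CuspFormCancellationU3Torus.diagonal_mul_mul_diagonal_apply]
    rw [hmat]
    refine valBound_diag_inv_conj_sub_one_le_pow hϖ d h1 ((hmem c x).1 hxc).1 (fun i j hij hne => ?_) hjc
    rcases lt_or_gt_of_ne hij with hlt | hgt
    · exact (v_ratio_le_inv_of_lt σ hσv hJ hd hplus hlt).trans hρ
    · exact absurd (h0 i j hgt) hne
  refine mem_level_of_valBound σ (K2E3CuspFormCancellationU3Inputs.valuation_pow_le_one hϖ j) (key n hn hnc) ?_
  have e : ((a⁻¹ * n * a : ↥(unitaryGroupOfForm σ J)) : GL (Fin 2) K)⁻¹ = ((a⁻¹ * n⁻¹ * a : ↥(unitaryGroupOfForm σ J)) : GL (Fin 2) K) := by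
    rw [← Subgroup.coe_inv]; congr 1; group
  rw [e]
  exact key n⁻¹ ((borelTriple σ J hJ).N.inv_mem hn) (hinv c n hnc)

include hσv hJ hϖ hmem hinv in
/-- **`hminusC`** (Lemma 55 for `A⁻` on `N̄`): for `a ∈ A⁻` with `a ∉ Ω_h`, `j + c ≤ h + 1`, and `v ∈ N̄ ∩ Ω_c`: `a⁻¹ v a ∈ K_{|ϖ|^j}` (root values below the diagonal
`≤ |d₀| ≤ |ϖ^{h+1}|`). [cite: HarishChandra1970, Part VII §8 Lemma 55 p. 83] [cite: Casselman1995, Prop. 1.4.3] -/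
theorem inv_conj_mem_level_of_minus_of_mem_Nbar :
    ∀ a ∈ {a : ↥(unitaryGroupOfForm σ J) | ∃ d : Fin 2 → Kˣ, glDiagonal 2 K d = (a : GL (Fin 2) K) ∧ Valued.v (d 0 : K) ≤ 1},
      ∀ (h c j : ℕ), a ∉ Ω h → j + c ≤ h + 1 → ∀ v ∈ ((borelTriple σ J hJ).N).map (MulAut.conj (weylLongU σ hJ)).toMonoidHom, v ∈ Ω c →
        a⁻¹ * v * a ∈ (congruenceGL 2 (valuation K ϖ ^ j)).comap (unitaryGroupOfForm σ J).subtype := by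
  rintro a ⟨d, hd, hminus⟩ h c j hah hjc v hv hvc
  have hρ : Valued.v (d 0 : K) ≤ Valued.v (ϖ ^ (h + 1)) := v_le_pow_succ_of_not_mem σ hσv hJ hϖ Ω hmem hd hminus hah
  have key : ∀ x : ↥(unitaryGroupOfForm σ J), x ∈ ((borelTriple σ J hJ).N).map (MulAut.conj (weylLongU σ hJ)).toMonoidHom → x ∈ Ω c →
      ValBound (valuation K ϖ ^ j) ((((a⁻¹ * x * a : ↥(unitaryGroupOfForm σ J)) : GL (Fin 2) K) : Matrix (Fin 2) (Fin 2) K) - 1) := by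
    intro x hxN hxc
    obtain ⟨h1, h0⟩ := apply_of_mem_Nbar σ hJ hxN
    have hmat : (((a⁻¹ * x * a : ↥(unitaryGroupOfForm σ J)) : GL (Fin 2) K) : Matrix (Fin 2) (Fin 2) K) =
        diagonal (fun i => ((d i : K))⁻¹) * ((x : GL (Fin 2) K) : Matrix (Fin 2) (Fin 2) K) * diagonal fun i => (d i : K) := by
      ext i j; rw [coe_inv_conj_diag_apply σ hd, K2E3CuspFormCancellationU3Torus.diagonal_mul_mul_diagonal_apply]
    rw [hmat]
    refine valBound_diag_inv_conj_sub_one_le_pow hϖ d h1 ((hmem c x).1 hxc).1 (fun i j hij hne => ?_) hjc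
    rcases lt_or_gt_of_ne hij with hlt | hgt
    · exact absurd (h0 i j hlt) hne
    · exact (v_ratio_le_of_gt σ hσv hJ hd hminus hgt).trans hρ
  refine mem_level_of_valBound σ (K2E3CuspFormCancellationU3Inputs.valuation_pow_le_one hϖ j) (key v hv hvc) ?_
  have e : ((a⁻¹ * v * a : ↥(unitaryGroupOfForm σ J)) : GL (Fin 2) K)⁻¹ = ((a⁻¹ * v⁻¹ * a : ↥(unitaryGroupOfForm σ J)) : GL (Fin 2) K) := by
    rw [← Subgroup.coe_inv]; congr 1; group
  rw [e]
  exact key v⁻¹ (Subgroup.inv_mem _ hv) (hinv c v hvc)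

include hmem in
/-- **`K_γ ∩ U ⊆ Ω_0`** (★ (T20-c) §4 `forall_v_pow_zero_mul_le_one_of_mem_comap_congruenceGL` read through `hmem`). [cite: HarishChandra1970, Part VII §2 p. 69] -/
theorem coe_level_subset_heightBall_zero (γ : ValueGroupWithZero K) :
    (((congruenceGL 2 γ).comap (unitaryGroupOfForm σ J).subtype : Subgroup ↥(unitaryGroupOfForm σ J)) : Set ↥(unitaryGroupOfForm σ J)) ⊆ Ω 0 :=
  fun k hk => (hmem 0 k).2 (K2E3IwahoriFactorisedLevelU3.forall_v_pow_zero_mul_le_one_of_mem_comap_congruenceGL σ ϖ hk)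

end Model

end Summit.HodgeConjecture.HodgeConjecture.Cruxes.H413.K2E3CuspFormCancellationU2Inputs

end
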